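import Literature.AlgebraicGeometry.HodgeTheory.SimpleAbelianSevenfoldHodgeClassesAll
import Literature.AlgebraicGeometry.HodgeTheory.GenericAbelianSevenfoldPowersHodgeClasses
import Literature.AlgebraicGeometry.HodgeTheory.SimpleAbelianFivefoldPowersHodgeClasses
import HarnessLib

/-!
# Hodge classes on all powers of a SIMPLE complex abelian SEVENFOLD are generated by divisor classes
# (Tankeev–Ribet at the prime 7; Moonen–Zarhin 1999 Thm. (2.7)) — UNCONDITIONAL

Family `hodge`, layer `Literature/AlgebraicGeometry/HodgeTheory`. Research context: cell `pub-hodge-ring2` (HONEST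
FRAMING: research route conditional on HC_CM; not a corollary; Q11.4-sentence-2 already refuted in dim ≥ 3),
Literature lane gen 83, programme R63, THE CENSUS OF DIMENSION SEVEN. UNCONDITIONAL; theorems only, no definition,
no named fact (D-0026), no `sorry`. It is the dimension-`7` twin of the tree's `SimpleAbelianFivefoldPowersHodgeClasses`
(lit gen 68): the last open Albert shape of a simple abelian sevenfold, `End⁰(X) = ℚ` (type I(1), `Hg = Sp₁₄`), is the
tree's `AbelianVariety.isDivisorGenerated_powSucc_of_sevenfold_endRankOne` (`GenericAbelianSevenfoldPowersHodgeClasses`,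
this programme: the rank-fourteen Θ-subalgebra theorem); every other shape is the tree's
`isDivisorGenerated_powSucc_of_isSimple_sevenfold_of_generic` (`SimpleAbelianSevenfoldHodgeClassesAll`, lit gen 83
R61/R62: totally real degree `7` impossible, CM by Pohlmann, imaginary quadratic `End⁰` with signatures
`(1,6)`, `(2,5)`, `(3,4)` and their mirrors by the type-one theorem and the Hermitian cores `(2, odd)`, `(3, 3∤b)`).

THE PRINTED THEOREM. B. Moonen, Yu. Zarhin, *Hodge classes on abelian varieties of low dimension*, Math. Ann. 315
(1999), Thm. (2.7) [held `paper:arxiv-math_9901113` p0005]: «Let `X` be a simple complex abelian variety such that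
`dim(X)` is a prime number. Then `Hg(X) = Sp_D(V,φ)` and `B•(Xⁿ) = D•(Xⁿ)` for every `n ≥ 1`. In particular, the Hodge
conjecture is true for all `Xⁿ`» (Tankeev [Tankeev1983]; Ribet [Ribet1983, Thms. 0–3]). Here: the prime `7`.

* **`AbelianVariety.isDivisorGenerated_powSucc_of_isSimple_of_dim_seven`** — `B = D` on all powers of every simple
  complex abelian sevenfold; **`hodgeConjectureFor_powSucc_of_isSimple_of_dim_seven`** — the Hodge conjecture for all of
  them; the isogeny class; `tankeevRibet1983_of_dim_seven` (the `p = 7` slice of the tree's named fact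
  `TankeevRibet1983_hodgeClasses_divisorial_powers_simplePrimeDimension`, now a theorem).
* `tankeevRibet1983_iff_prime_ge_eleven_nonCM`, `tankeevRibet1983_iff_generic_and_unitary_ge_four_prime_ge_eleven` —
  what remains of that named fact: simple, non-CM, prime dimension `p ≥ 11`; equivalently its two residual shapes
  `End⁰ = ℚ` (`Hg = Sp_{2p}`) and `End⁰ = k` imaginary quadratic with both multiplicities `≥ 4`, in prime dimension `≥ 11`.

## References
* [MoonenZarhin1999LowDim] B. Moonen, Yu. Zarhin, Math. Ann. 315 (1999), §2 (2.4)–(2.7), p. 715.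
* [Tankeev1983] S. G. Tankeev, *Cycles on simple abelian varieties of prime dimension*, Math. USSR Izv. 20 (1983).
* [Ribet1983] K. A. Ribet, *Hodge classes on certain types of abelian varieties*, Amer. J. Math. 105 (1983), Thms. 0–3.
* [Gordon1999HodgeAVSurvey] B. B. Gordon, *A survey of the Hodge conjecture for abelian varieties*, Thm. 6.3.
* [vanGeemen1994HodgeAV] B. van Geemen, *An introduction to the Hodge conjecture for abelian varieties* (1994), Thm. 4.6, Lemma 3.7.
* [Pohlmann1968] H. Pohlmann, Ann. of Math. 88 (1968), Thm. 1.
-/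

noncomputable section

open CategoryTheory Module

namespace Literature.AlgebraicGeometry.HodgeTheory

open Literature.AlgebraicGeometry.Motives
open Literature.Barriers.HodgeConjecture (divisorClassesSpan)

section Main

/-- **`B•(A^{N+1}) = D•(A^{N+1}) ⊗ ℂ` for every power of every SIMPLE complex abelian SEVENFOLD — UNCONDITIONAL**
(Moonen–Zarhin 1999 Thm. (2.7) at the prime `7`; Tankeev; Ribet 1983 Thms. 0–3). The generic shape `End⁰ = ℚ` is
`AbelianVariety.isDivisorGenerated_powSucc_of_sevenfold_endRankOne` (`Hg = Sp₁₄`); the other Albert shapes are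
`isDivisorGenerated_powSucc_of_isSimple_sevenfold_of_generic`. «Let X be a simple complex abelian variety such that
dim(X) is a prime number. Then … B•(Xⁿ) = D•(Xⁿ) for every n ≥ 1» at the prime `7`.
[cite: MoonenZarhin1999LowDim, §2 (2.4)–(2.6), Thm. (2.7)] [cite: Tankeev1983, main theorem] [cite: Ribet1983, Thms. 0–3] -/
theorem AbelianVariety.isDivisorGenerated_powSucc_of_isSimple_of_dim_seven (A : AbelianVariety ℂ) (hA : A.IsSimple)
    (hdim : A.dim = 7) (N : ℕ) : IsDivisorGenerated (A.powSucc N) :=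
  isDivisorGenerated_powSucc_of_isSimple_sevenfold_of_generic hA hdim
    (fun h1 N => AbelianVariety.isDivisorGenerated_powSucc_of_sevenfold_endRankOne A h1 hdim N) N

/-- `IsStablyNondegenerate A` (`B = D` on all powers) for every simple complex abelian sevenfold.
[cite: MoonenZarhin1999LowDim, §2 condition (D) and Thm. (2.7)] -/
theorem AbelianVariety.isStablyNondegenerate_of_isSimple_of_dim_seven (A : AbelianVariety ℂ) (hA : A.IsSimple)
    (hdim : A.dim = 7) : IsStablyNondegenerate A :=
  fun N => AbelianVariety.isDivisorGenerated_powSucc_of_isSimple_of_dim_seven A hA hdim N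

/-- `A` itself: `B•(A) = D•(A) ⊗ ℂ` for a simple abelian sevenfold. [cite: MoonenZarhin1999LowDim, §2 Thm. (2.7)] -/
theorem AbelianVariety.isDivisorGenerated_of_isSimple_of_dim_seven (A : AbelianVariety ℂ) (hA : A.IsSimple)
    (hdim : A.dim = 7) : IsDivisorGenerated A :=
  (AbelianVariety.isStablyNondegenerate_of_isSimple_of_dim_seven A hA hdim).isDivisorGenerated

/-- **THE HODGE CONJECTURE FOR EVERY POWER `A^{N+1}` OF EVERY SIMPLE COMPLEX ABELIAN SEVENFOLD — UNCONDITIONAL.**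
MZ99 Thm. (2.7): «In particular, the Hodge conjecture is true for all Xⁿ» (prime dimension; here `7`).
[cite: MoonenZarhin1999LowDim, §2 Thm. (2.7)] [cite: vanGeemen1994HodgeAV, Thm. 4.6 and §2.4] [cite: Deligne2000, §1] -/
theorem hodgeConjectureFor_powSucc_of_isSimple_of_dim_seven (A : AbelianVariety ℂ) (hA : A.IsSimple)
    (hdim : A.dim = 7) (N : ℕ) : HodgeConjectureFor (A.powSucc N).dim (A.powSucc N).X :=
  hodgeConjectureFor_of_isDivisorGenerated _
    (AbelianVariety.isDivisorGenerated_powSucc_of_isSimple_of_dim_seven A hA hdim N)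

/-- The Hodge conjecture for a simple abelian sevenfold itself. [cite: MoonenZarhin1999LowDim, §2 Thm. (2.7)] -/
theorem hodgeConjectureFor_of_isSimple_of_dim_seven (A : AbelianVariety ℂ) (hA : A.IsSimple) (hdim : A.dim = 7) :
    HodgeConjectureFor A.dim A.X :=
  hodgeConjectureFor_of_isDivisorGenerated _ (AbelianVariety.isDivisorGenerated_of_isSimple_of_dim_seven A hA hdim)

/-- **The Hodge conjecture for every complex abelian variety isogenous to a power of a simple abelian sevenfold.**
[cite: MoonenZarhin1999LowDim, §2 Thm. (2.7)] [cite: vanGeemen1994HodgeAV, Lemma 3.7] -/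
theorem hodgeConjectureFor_of_isIsogenous_powSucc_of_isSimple_of_dim_seven {A B : AbelianVariety ℂ}
    (hA : A.IsSimple) (hdim : A.dim = 7) {N : ℕ} (hB : B.IsIsogenous (A.powSucc N)) :
    HodgeConjectureFor B.dim B.X :=
  HodgeConjectureFor.of_isIsogenous hB (hodgeConjectureFor_powSucc_of_isSimple_of_dim_seven A hA hdim N)

/-- `B = D` for every complex abelian variety isogenous to a power of a simple abelian sevenfold.
[cite: MoonenZarhin1999LowDim, §2 Thm. (2.7)] -/
theorem isDivisorGenerated_of_isIsogenous_powSucc_of_isSimple_of_dim_seven {A B : AbelianVariety ℂ}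
    (hA : A.IsSimple) (hdim : A.dim = 7) {N : ℕ} (hB : B.IsIsogenous (A.powSucc N)) : IsDivisorGenerated B :=
  (AbelianVariety.isDivisorGenerated_powSucc_of_isSimple_of_dim_seven A hA hdim N).of_isIsogenous hB

/-- The cycle part in the fact's consequence shape: every rational `(m,m)`-class on every power of a simple abelian
sevenfold is algebraic. [cite: MoonenZarhin1999LowDim, §2 Thm. (2.7)] -/
theorem hodgeClasses_algebraic_powSucc_of_isSimple_of_dim_seven (A : AbelianVariety ℂ) (hA : A.IsSimple)
    (hdim : A.dim = 7) (N m : ℕ) (c : complexBetti (A.powSucc N).X (2 * m)) (hc : IsRationalClass c)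
    (hmm : IsOfHodgeType (A.powSucc N).dim (A.powSucc N).X (2 * m) m m c) :
    c ∈ algebraicClasses (A.powSucc N).X m :=
  (hodgeConjectureFor_powSucc_of_isSimple_of_dim_seven A hA hdim N).2 m c hc hmm

/-- **The `p = 7` slice of the tree's named fact `TankeevRibet1983_hodgeClasses_divisorial_powers_simplePrimeDimension`,
as a THEOREM**: for a SIMPLE complex abelian variety `X` of dimension `7`, every rational `(m,m)`-class on every power
`X^{N+1}` lies in `Dᵐ(X^{N+1}) ⊗ ℂ`. [cite: MoonenZarhin1999LowDim, §2 Thm. (2.7)]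
[cite: Gordon1999HodgeAVSurvey, Thm. 6.3 and Corollary] [cite: Tankeev1983, main theorem] -/
theorem tankeevRibet1983_of_dim_seven :
    ∀ (X : AbelianVariety ℂ), X.dim = 7 → X.IsSimple →
      ∀ (N m : ℕ) (c : complexBetti (X.powSucc N).X (2 * m)), IsRationalClass c →
        IsOfHodgeType (X.powSucc N).dim (X.powSucc N).X (2 * m) m m c →
          c ∈ divisorClassesSpan (X.powSucc N).X (X.powSucc N).dim m :=
  fun X hX hs N m c hc hmm => AbelianVariety.isDivisorGenerated_powSucc_of_isSimple_of_dim_seven X hs hX N m c hc hmm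

/-- **What remains of the Tankeev–Ribet fact after this file: simple, NON-CM, of prime dimension `p ≥ 11`.**
(`p = 2, 3, 5`: the tree's `tankeevRibet1983_of_dim_two/three/five`; `p = 7`: `tankeevRibet1983_of_dim_seven`; CM:
Pohlmann.) [cite: MoonenZarhin1999LowDim, §2 Thm. (2.7)] [cite: Gordon1999HodgeAVSurvey, Thm. 6.3 and Corollary] -/
theorem tankeevRibet1983_iff_prime_ge_eleven_nonCM :
    TankeevRibet1983_hodgeClasses_divisorial_powers_simplePrimeDimension ↔
      ∀ (X : AbelianVariety ℂ) (p : ℕ), p.Prime → 11 ≤ p → X.dim = p → X.IsSimple →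
        ¬ Literature.AlgebraicGeometry.Milne1999.IsOfCMType X →
        ∀ (N m : ℕ) (c : complexBetti (X.powSucc N).X (2 * m)), IsRationalClass c →
          IsOfHodgeType (X.powSucc N).dim (X.powSucc N).X (2 * m) m m c →
            c ∈ divisorClassesSpan (X.powSucc N).X (X.powSucc N).dim m := by
  rw [tankeevRibet1983_iff_prime_ge_seven_nonCM]
  refine ⟨fun h X p hp h11 hX hs hcm => h X p hp (by omega) hX hs hcm, fun h X p hp h7 hX hs hcm N m c hc hmm => ?_⟩
  by_cases hp7 : p = 7
  · subst hp7
    exact tankeevRibet1983_of_dim_seven X hX hs N m c hc hmm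
  · have h11 : 11 ≤ p := by
      rcases Nat.lt_or_ge p 11 with hlt | hge
      · interval_cases p <;> first | exact absurd hp (by decide) | omega
      · exact hge
    exact h X p hp h11 hX hs hcm N m c hc hmm

/-- **The Tankeev–Ribet fact is EQUIVALENT to its two residual shapes in prime dimension `p ≥ 11`**: (S1) `End⁰ = ℚ`
(the symplectic shape `Hg = Sp_{2p}`, Ribet's Thm. 1 with `E = ℚ`) and (S2⁗) `End⁰ = k` imaginary quadratic acting with
BOTH multiplicities `n', n'' ≥ 4` (Ribet's Thm. 3 beyond the tree's classification-free cores `(1,·)`, `(2, odd)`,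
`(3, 3 ∤ ·)`); refines the tree's `tankeevRibet1983_iff_generic_and_unitary_shapes_prime_ge_seven` and
`tankeevRibet1983_iff_generic_and_unitary_ge_four` by the prime `7`, now a theorem.
[cite: MoonenZarhin1999LowDim, §2 (2.4)–(2.7)] [cite: Gordon1999HodgeAVSurvey, Thm. 6.3 and Corollary] [cite: Ribet1983, Thms. 1 and 3] -/
theorem tankeevRibet1983_iff_generic_and_unitary_ge_four_prime_ge_eleven :
    TankeevRibet1983_hodgeClasses_divisorial_powers_simplePrimeDimension ↔
      (∀ X : AbelianVariety ℂ, X.dim.Prime → 11 ≤ X.dim → X.IsSimple → Module.finrank ℚ X.endAlgebra = 1 →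
        ∀ N : ℕ, IsDivisorGenerated (X.powSucc N)) ∧
      (∀ (X : AbelianVariety ℂ) (φ : X ⟶ X) (d : ℕ), X.dim.Prime → 11 ≤ X.dim → X.IsSimple → 0 < d →
        φ ≫ φ = -(d • 𝟙 X) → Module.finrank ℚ X.endAlgebra = 2 →
        4 ≤ eigenMultiplicity X φ (Complex.I * (Real.sqrt d : ℂ)) →
        4 ≤ eigenMultiplicity X φ (-(Complex.I * (Real.sqrt d : ℂ))) → ∀ N : ℕ, IsDivisorGenerated (X.powSucc N)) := by
  refine ⟨fun h => ⟨fun X hp _ hs _ N m c hc hmm => h X X.dim hp rfl hs N m c hc hmm,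
    fun X φ d hp _ hs _ _ _ _ _ N m c hc hmm => h X X.dim hp rfl hs N m c hc hmm⟩, fun ⟨hS1, hS4⟩ => ?_⟩
  rw [tankeevRibet1983_iff_prime_ge_eleven_nonCM]
  intro X p hp h11 hX hs _ N m c hc hmm
  have hp' : X.dim.Prime := hX ▸ hp
  have hodd : Odd X.dim := hX ▸ hp.odd_of_ne_two (by omega)
  exact isDivisorGenerated_powSucc_of_isSimple_of_prime_of_odd_of_ge_four hs hp' hodd
    (fun he1 N => hS1 X hp' (by omega) hs he1 N)
    (fun φ d hd hφ he2 ha hb N => hS4 X φ d hp' (by omega) hs hd hφ he2 ha hb N) N m c hc hmm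

end Main

end Literature.AlgebraicGeometry.HodgeTheory

end
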